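import Literature.Probability.RandomPlanarGeometry.SAWPolygonDiameterClasses
import HarnessLib

/-!
# Tall polygons: at least half of `SAP_n` (up to translation) is tall, and a tall `n`-gon has height `h`
# with `(h+1)² ≥ n`

Topic `Literature/Probability/RandomPlanarGeometry`, on top of `SAWPolygonDiameterClasses.lean` (the coordinate swap
`swapEdges` of an edge set of `ℤ²` — polygons go to polygons, normal position is preserved, an involution; the extents
`xExt`, `yExt`; `card_le_xExt_succ_mul_yExt_succ : N ≤ (xExt + 1)(yExt + 1)` for `E ∈ normPolygons N`) and
`SAWWidePolygons.lean` (`normPolygons n` = the `n`-edge self-avoiding polygons of `ℤ²` in normal position, one per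
translation class).

Source context: N. Madras, *A rigorous bound on the critical exponent for the number of lattice trees, animals,
and polygons*, J. Statist. Phys. 78 (1995) 681–699, and the account in A. Hammond, arXiv:1504.05286, §2.1: Madras'
join of two polygons uses that, by the symmetry `x ↔ y`, at least half of the `n`-step polygons are at least as
tall as wide, and that a tall `n`-gon has height of order `√n` (its `n` vertices sit in a `(w+1)×(h+1)` box with
`w ≤ h`); the same rotation step is Duminil-Copin–Ganguly–Hammond–Manolescu 2020, proof of Lemma 3.3 (tree:
`exists_heavy_wideLow_class`). What is proved here (lane pcv-sawmu, planner route «MAD95-2JP» items S1a `TallHalf`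
and S1b `TallHeight`, statements verbatim the planner's typed Props): **`#normPolygons n ≤ 2·#{E ∈ normPolygons n :
IsTall E}`** (the swap sends every non-tall normal polygon injectively to a tall one) and **every tall
`E ∈ normPolygons n` has two vertices `a, b` with `n ≤ (a₁ − b₁ + 1)²`** (for tall normal `E`, `xExt E ≤ yExt E`).

## Contents (namespace `Literature.Probability.RandomPlanarGeometry.SAW`)
* `IsTall E` — `width ≤ height`, phrased with witnesses (verbatim the planner's definition);
* `isTall_swapEdges_of_not_isTall`; **`card_normPolygons_le_two_mul_card_filter_isTall`** (S1a `TallHalf`);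
* `xExt_le_yExt_of_isTall`; **`exists_height_sq_ge_of_isTall`** (S1b `TallHeight`).
-/

noncomputable section

open Finset SimpleGraph Literature.Probability.LatticeModels Literature.Probability.Percolation
open Literature.Probability.Percolation.SiteGadgetSystem (vertsOf mem_vertsOf)

namespace Literature.Probability.RandomPlanarGeometry.SAW

/-! ### Tall polygons -/

/-- **Tall** edge sets: `height(E) ≥ width(E)`, phrased without `sup`/`inf` — some height difference
`a₁ − b₁` of two vertices dominates every width difference (verbatim the lane planner's `IsTall`).
[cite: Madras1995LatticeAnimalsExponent, §2 (polygons at least as tall as wide); DuminilCopinGangulyHammondManolescu2020, §3.1 (proof of Lemma 3.3: "at least as wide as they are high")] -/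
def IsTall (E : Finset (Sym2 (Site 2))) : Prop :=
  ∃ a ∈ vertsOf E, ∃ b ∈ vertsOf E, ∀ v ∈ vertsOf E, ∀ w ∈ vertsOf E, v 0 - w 0 ≤ a 1 - b 1

/-- A non-tall edge set (with a vertex) becomes tall after the swap: its width strictly exceeds its height, and
the swap exchanges the two. [cite: DuminilCopinGangulyHammondManolescu2020, §3.1 (proof of Lemma 3.3: "any polygon that does not satisfy this condition is the right-angled rotation of one that does")] -/
theorem isTall_swapEdges_of_not_isTall {E : Finset (Sym2 (Site 2))} (hne : (vertsOf E).Nonempty)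
    (h : ¬ IsTall E) : IsTall (swapEdges E) := by
  -- extremal vertices of `E` in each coordinate
  obtain ⟨ax, hax, haxm⟩ := exists_max_image (vertsOf E) (fun v => v 0) hne
  obtain ⟨bx, hbx, hbxm⟩ := exists_min_image (vertsOf E) (fun v => v 0) hne
  obtain ⟨ay, hay, haym⟩ := exists_max_image (vertsOf E) (fun v => v 1) hne
  obtain ⟨bY, hbY, hbYm⟩ := exists_min_image (vertsOf E) (fun v => v 1) hne
  -- `¬ IsTall`: the height `ay₁ − bY₁` is beaten by some width difference, itself `≤ ax₀ − bx₀`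
  simp only [IsTall, not_exists, not_and, not_forall, not_le] at h
  obtain ⟨v, hv, w, hw, hlt⟩ := h ay hay bY hbY
  have hW : v 0 - w 0 ≤ ax 0 - bx 0 := by linarith [haxm v hv, hbxm w hw]
  refine ⟨swapSite ax, mem_vertsOf_swapEdges.2 (by rwa [swapSite_swapSite]),
    swapSite bx, mem_vertsOf_swapEdges.2 (by rwa [swapSite_swapSite]), fun v' hv' w' hw' => ?_⟩
  rw [swapSite_one, swapSite_one]
  have h1 := haym _ (mem_vertsOf_swapEdges.1 hv')
  have h2 := hbYm _ (mem_vertsOf_swapEdges.1 hw')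
  rw [swapSite_one] at h1 h2
  linarith

open Classical in
/-- **S1a (`TallHalf`): at least half of `SAP_n` is tall** — `#normPolygons n ≤ 2·#{E ∈ normPolygons n : IsTall E}`:
the coordinate swap is an involution of `normPolygons n` sending the non-tall polygons injectively into the tall ones.
[cite: Madras1995LatticeAnimalsExponent, §2 (polygons: by symmetry at least half are at least as tall as wide); DuminilCopinGangulyHammondManolescu2020, §3.1 (proof of Lemma 3.3)] -/
theorem card_normPolygons_le_two_mul_card_filter_isTall :
    ∀ n : ℕ, (normPolygons n).card ≤ 2 * ((normPolygons n).filter IsTall).card := by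
  intro n
  have hsplit := Finset.card_filter_add_card_filter_not (s := normPolygons n) IsTall
  have hinj : ((normPolygons n).filter fun E => ¬ IsTall E).card ≤ ((normPolygons n).filter IsTall).card := by
    refine Finset.card_le_card_of_injOn swapEdges (fun E hE => ?_) (fun E _ F _ hEF => swapEdges_injective hEF)
    rw [Finset.mem_coe, Finset.mem_filter] at hE ⊢
    refine ⟨swapEdges_mem_normPolygons hE.1, isTall_swapEdges_of_not_isTall ?_ hE.2⟩
    obtain ⟨-, ⟨v, hv, -⟩, -⟩ := (mem_normPolygons.1 hE.1).2.2
    exact ⟨v, hv⟩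
  omega

/-! ### A tall `n`-gon has height `h` with `(h+1)² ≥ n` -/

/-- For a tall NORMAL edge set, `xExt ≤ yExt` (the width `v₀ − 0` of every vertex is at most a height difference,
itself at most `yExt − 0`). [cite: DuminilCopinGangulyHammondManolescu2020, §3.1 (width, height)] -/
theorem xExt_le_yExt_of_isTall {E : Finset (Sym2 (Site 2))} (hN : IsNormal E) (hT : IsTall E) : xExt E ≤ yExt E := by
  obtain ⟨hpos, ⟨vx, hvx, hvx0⟩, -⟩ := hN
  obtain ⟨a₀, ha₀, b₀, hb₀, hx⟩ := hT
  refine Finset.sup_le fun v hv => ?_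
  have h1 := hx v hv vx hvx
  rw [hvx0, sub_zero] at h1
  have h2 : ((a₀ 1).toNat : ℤ) = a₀ 1 := Int.toNat_of_nonneg (hpos a₀ ha₀).2
  have h3 := toNat_apply_one_le_yExt ha₀
  have h4 := (hpos b₀ hb₀).2
  have h5 : v 0 ≤ yExt E := by
    have : ((a₀ 1).toNat : ℤ) ≤ yExt E := by exact_mod_cast h3
    linarith
  exact (Int.toNat_le_toNat h5).trans (by simp)

/-- **S1b (`TallHeight`): a tall `n`-gon has height `h` with `(h+1)² ≥ n`** — every tall `E ∈ normPolygons n` has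
vertices `a, b` with `n ≤ (a₁ − b₁ + 1)²`: with `b` on the axis `y = 0` and `a` of maximal height `yExt E`, by
`n ≤ (xExt + 1)(yExt + 1)` and `xExt ≤ yExt`. [cite: Madras1995LatticeAnimalsExponent, §2 (a tall n-gon has height of order √n); DuminilCopinGangulyHammondManolescu2020, §3.1 (proof of Lemma 3.3: "m^{1/2} ≤ diam(p)")] -/
theorem exists_height_sq_ge_of_isTall :
    ∀ n : ℕ, ∀ E ∈ normPolygons n, IsTall E →
      ∃ a ∈ vertsOf E, ∃ b ∈ vertsOf E, (n : ℤ) ≤ (a 1 - b 1 + 1) ^ 2 := by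
  intro n E hE hT
  obtain ⟨-, -, hN⟩ := mem_normPolygons.1 hE
  obtain ⟨hpos, ⟨vx, hvx, -⟩, ⟨vy, hvy, hvy0⟩⟩ := hN
  obtain ⟨a, ha, hay⟩ := exists_toNat_apply_one_eq_yExt (E := E) ⟨vx, hvx⟩
  have hbox := card_le_xExt_succ_mul_yExt_succ hE
  have hxy := xExt_le_yExt_of_isTall (mem_normPolygons.1 hE).2.2 hT
  have hn : n ≤ (yExt E + 1) * (yExt E + 1) := hbox.trans (Nat.mul_le_mul_right _ (by omega))
  refine ⟨a, ha, vy, hvy, ?_⟩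
  have ha1 : a 1 = yExt E := by rw [← hay]; exact (Int.toNat_of_nonneg (hpos a ha).2).symm
  rw [hvy0, sub_zero, ha1]
  have : ((n : ℕ) : ℤ) ≤ (((yExt E + 1) * (yExt E + 1) : ℕ) : ℤ) := by exact_mod_cast hn
  push_cast at this
  nlinarith [this]

end Literature.Probability.RandomPlanarGeometry.SAW

end
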